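import Literature.AnabelianGeometry.SemiGraphs.TemperedPiDecompositionEdges
import HarnessLib

/-!
# Decomposition homomorphisms under translation by `π₁^temp(𝒢)` ([SemiAnbd] §3 pp. 40–41)

Mochizuki, *Semi-graphs of anabelioids*, Publ. RIMS **42** (2006), §3, Thm. 3.7 (i)–(ii), author's
manuscript p. 40 [cite: MochizukiSemiAnbd2006, Thm 3.7(i) p.40]: the verticial subgroups are the images
`π̂₁(𝒢_v) ↪ π₁^temp(𝒢)` "[well-defined up to conjugation]" and are "parametrized by a vertex `v` of `𝒢`
and an element of the coset space `π₁^temp(𝒢)/π̂₁(𝒢_v)`".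

Sequel to `TemperedPiDecomposition(Edges).lean` (seat abc-iut-L3-t6, row «DECOMP»): an element
`g ∈ π₁^temp(𝒢) = lim_n Aut(𝒢_{∞,n})` translates a compatible (edge-)point sequence `t` of the tower to
`g · t` (`PointSeq.smul`, `EdgeSeq.smul`), with vertex (edge) system the `g`-translate of that of `t`
(`smul_vertex`, `smul_edge`), and the decomposition homomorphism at `g · t` is the CONJUGATE by `g` of
the one at `t` (`decompHom_smul`, `decompHomE_smul`): so the conjugates of the images `ψ_t(Π_v)` are
again images of decomposition homomorphisms — the tree-side input for deriving (I1) of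
`TemperedLevelData.lean` from the conjugacy of verticial homomorphisms (chart side, abc-iut-L3-t8).
Moreover `π₁^temp(𝒢)` acts TRANSITIVELY on the compatible (edge-)point sequences over a fixed vertex
(edge) (`exists_smul_eq`, `exists_smul_eqE`: levelwise transitivity + rigidity + the descent square),
so any two decomposition homomorphisms over the same vertex (edge) are conjugate
(`exists_decompHom_eq_conj`, `exists_decompHomE_eq_conj`) — the tree-side content of Thm. 3.7 (ii),
p. 40: the verticial subgroups "may be thought of as being parametrized by a vertex `v` of `𝒢` and
an element of the coset space `π₁^temp(𝒢)/π̂₁(𝒢_v)`".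
Nothing here bears on [IUTchIII] Cor. 3.12.
-/

namespace Literature.AnabelianGeometry.SemiGraphs

namespace ProfiniteSemiGraph

namespace GaloisLevelData

open CategoryTheory

universe u

variable {𝒢 : ProfiniteSemiGraph.{u}} {D : GaloisLevelData 𝒢} {h𝒢 : 𝒢.IsCountable}

/-- Components of `π₁^temp` act by automorphisms: `σ⁻¹ (σ t) = t` on vertex fibres.
[cite: MochizukiSemiAnbd2006, Prop 3.6 p.38] -/
theorem gal_inv_hom_apply (n : ℕ) (σ : D.Gal h𝒢 n) {v : 𝒢.graph.Vertex} (t : ((D.cover h𝒢 n).SV v).obj.V) :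
    ((σ.inv.fV v).hom.hom ((σ.hom.fV v).hom.hom t)) = t :=
  congrArg (fun φ : D.cover h𝒢 n ⟶ D.cover h𝒢 n => (φ.fV v).hom.hom t) σ.hom_inv_id

/-- The same on edge fibres. [cite: MochizukiSemiAnbd2006, Prop 3.6 p.38] -/
theorem gal_inv_hom_applyE (n : ℕ) (σ : D.Gal h𝒢 n) {e : 𝒢.graph.Edge} (t : ((D.cover h𝒢 n).SE e).obj.V) :
    ((σ.inv.fE e).hom.hom ((σ.hom.fE e).hom.hom t)) = t :=
  congrArg (fun φ : D.cover h𝒢 n ⟶ D.cover h𝒢 n => (φ.fE e).hom.hom t) σ.hom_inv_id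

/-- The `hom` of a conjugate in `G_n = Aut(𝒢_{∞,n})`. [cite: MochizukiSemiAnbd2006, Prop 3.6 p.38] -/
theorem conj_hom (n : ℕ) (σ τ : D.Gal h𝒢 n) : (σ * τ * σ⁻¹).hom = σ.inv ≫ τ.hom ≫ σ.hom := rfl

namespace PointSeq

variable {v : 𝒢.graph.Vertex} (T : D.PointSeq h𝒢 v)

/-- **The translate `g · t` of a compatible point sequence by `g ∈ π₁^temp(𝒢)`** (apply the `n`-th
component of `g` to `t n`; compatible by the descent square of the tower).
[cite: MochizukiSemiAnbd2006, Thm 3.7(i) p.40] -/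
noncomputable def smul (g : D.temperedPi h𝒢) : D.PointSeq h𝒢 v where
  pt n := ((D.proj h𝒢 n g).hom.fV v).hom.hom (T.pt n)
  compat n := by rw [D.stepCover_apply_aut h𝒢 n, T.compat n, D.step_proj]

/-- The points of the translate. [cite: MochizukiSemiAnbd2006, Thm 3.7(i) p.40] -/
theorem smul_pt (g : D.temperedPi h𝒢) (n : ℕ) :
    (T.smul g).pt n = ((D.proj h𝒢 n g).hom.fV v).hom.hom (T.pt n) := rfl

/-- The vertex system of the translate is the translate of the vertex system.
[cite: MochizukiSemiAnbd2006, Thm 3.7(i) p.40] -/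
theorem smul_vertex (g : D.temperedPi h𝒢) (n : ℕ) :
    (T.smul g).vertex n = (D.treeAct h𝒢 n g).hom.vertexMap (T.vertex n) := by
  unfold vertex
  rw [D.treeAct_apply, D.galTreeAct_vertexMap_mk h𝒢 n]
  rfl

/-- **The decomposition homomorphism at `g · t` is the conjugate by `g` of the one at `t`.**
[cite: MochizukiSemiAnbd2006, Thm 3.7(i) p.40] -/
theorem decompHom_smul (g : D.temperedPi h𝒢) (h : 𝒢.Gv v) :
    (T.smul g).decompHom h = g * T.decompHom h * g⁻¹ := by
  symm
  apply (T.smul g).eq_decompHom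
  intro n
  rw [map_mul, map_mul, map_inv, conj_hom]
  change ((D.proj h𝒢 n g).hom.fV v).hom.hom ((((D.proj h𝒢 n (T.decompHom h))).hom.fV v).hom.hom
    (((D.proj h𝒢 n g).inv.fV v).hom.hom (((D.proj h𝒢 n g).hom.fV v).hom.hom (T.pt n)))) =
    ((D.cover h𝒢 n).SV v).obj.ρ h⁻¹ (((D.proj h𝒢 n g).hom.fV v).hom.hom (T.pt n))
  rw [gal_inv_hom_apply, T.proj_decompHom_apply n h, CovHom.fV_ρ]

/-- Hence the conjugate of the image at `t` is the image at `g · t`. [cite: MochizukiSemiAnbd2006, Thm 3.7(i) p.40] -/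
theorem range_decompHom_smul (g : D.temperedPi h𝒢) :
    ((T.smul g).decompHom).range = (T.decompHom).range.map (MulAut.conj g).toMonoidHom := by
  ext x
  constructor
  · rintro ⟨h, rfl⟩
    exact ⟨T.decompHom h, ⟨h, rfl⟩, (T.decompHom_smul g h).symm⟩
  · rintro ⟨y, ⟨h, rfl⟩, rfl⟩
    exact ⟨h, T.decompHom_smul g h⟩

/-! ### `π₁^temp(𝒢)` acts transitively on the compatible point sequences over `v` -/

/-- Extensionality for compatible point sequences. [cite: MochizukiSemiAnbd2006, Thm 3.7(i) p.40] -/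
theorem ext {T T' : D.PointSeq h𝒢 v} (h : ∀ n, T.pt n = T'.pt n) : T = T' := by
  obtain ⟨p, c⟩ := T
  obtain ⟨p', c'⟩ := T'
  obtain rfl : p = p' := funext h
  rfl

/-- The automorphism of `𝒢_{∞,n}` carrying `t n` to `t' n` (a choice; unique by rigidity).
[cite: MochizukiSemiAnbd2006, Prop 3.6 p.38] -/
noncomputable def transporterGal (T' : D.PointSeq h𝒢 v) (n : ℕ) : D.Gal h𝒢 n :=
  ((D.S n).exists_aut_apply_eq' h𝒢 (D.W n) (D.htrans n) (T.pt n) (T'.pt n)).choose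

/-- Its defining property. [cite: MochizukiSemiAnbd2006, Prop 3.6 p.38] -/
theorem transporterGal_apply (T' : D.PointSeq h𝒢 v) (n : ℕ) :
    (((T.transporterGal T' n).hom.fV v).hom.hom (T.pt n)) = T'.pt n :=
  ((D.S n).exists_aut_apply_eq' h𝒢 (D.W n) (D.htrans n) (T.pt n) (T'.pt n)).choose_spec

/-- Uniqueness of the transporting automorphism (rigidity). [cite: MochizukiSemiAnbd2006, Prop 3.6 p.38] -/
theorem eq_transporterGal (T' : D.PointSeq h𝒢 v) (n : ℕ) (η : D.Gal h𝒢 n)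
    (hη : (η.hom.fV v).hom.hom (T.pt n) = T'.pt n) : η = T.transporterGal T' n :=
  Iso.ext ((D.S n).univCoverOver_hom_ext (Sum.inl (D.W n)) h𝒢 _ _ (T.pt n)
    (hη.trans (T.transporterGal_apply T' n).symm))

/-- The transporting automorphisms are compatible with `step`. [cite: MochizukiSemiAnbd2006, Prop 3.6 p.38] -/
theorem step_transporterGal (T' : D.PointSeq h𝒢 v) (n : ℕ) :
    D.step h𝒢 n (T.transporterGal T' (n + 1)) = T.transporterGal T' n := by
  apply T.eq_transporterGal T'
  rw [← T.compat n, ← D.stepCover_apply_aut h𝒢 n, T.transporterGal_apply T' (n + 1), T'.compat n]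

/-- **The element of `π₁^temp(𝒢)` carrying the point sequence `t` to `t'`.**
[cite: MochizukiSemiAnbd2006, Thm 3.7(ii) p.40] -/
noncomputable def transporter (T' : D.PointSeq h𝒢 v) : D.temperedPi h𝒢 :=
  D.mkPi h𝒢 (fun n => T.transporterGal T' n) (fun n => T.step_transporterGal T' n)

/-- `transporter t t' · t = t'`. [cite: MochizukiSemiAnbd2006, Thm 3.7(ii) p.40] -/
theorem smul_transporter (T' : D.PointSeq h𝒢 v) : T.smul (T.transporter T') = T' :=
  PointSeq.ext fun n => T.transporterGal_apply T' n

/-- **`π₁^temp(𝒢)` acts transitively on the compatible point sequences over a vertex `v`.**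
[cite: MochizukiSemiAnbd2006, Thm 3.7(ii) p.40] -/
theorem exists_smul_eq (T' : D.PointSeq h𝒢 v) : ∃ g : D.temperedPi h𝒢, T.smul g = T' :=
  ⟨T.transporter T', T.smul_transporter T'⟩

/-- Hence **any two decomposition homomorphisms at point sequences over the same vertex are conjugate
in `π₁^temp(𝒢)`.** [cite: MochizukiSemiAnbd2006, Thm 3.7(i) p.40] -/
theorem exists_decompHom_eq_conj (T' : D.PointSeq h𝒢 v) :
    ∃ g : D.temperedPi h𝒢, ∀ h, T'.decompHom h = g * T.decompHom h * g⁻¹ := by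
  obtain ⟨g, rfl⟩ := T.exists_smul_eq T'
  exact ⟨g, T.decompHom_smul g⟩

end PointSeq

namespace EdgeSeq

variable {e : 𝒢.graph.Edge} (T : D.EdgeSeq h𝒢 e) (hc : 𝒢.graph.IsConnected)

/-- The translate `g · t` of a compatible edge-point sequence by `g ∈ π₁^temp(𝒢)`.
[cite: MochizukiSemiAnbd2006, Thm 3.7(iii) p.41] -/
noncomputable def smul (g : D.temperedPi h𝒢) : D.EdgeSeq h𝒢 e where
  pt n := ((D.proj h𝒢 n g).hom.fE e).hom.hom (T.pt n)
  compat n := by rw [D.stepCover_apply_autE h𝒢 n, T.compat n, D.step_proj]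

/-- The points of the translate. [cite: MochizukiSemiAnbd2006, Thm 3.7(iii) p.41] -/
theorem smul_pt (g : D.temperedPi h𝒢) (n : ℕ) :
    (T.smul g).pt n = ((D.proj h𝒢 n g).hom.fE e).hom.hom (T.pt n) := rfl

/-- The edge system of the translate is the translate of the edge system.
[cite: MochizukiSemiAnbd2006, Thm 3.7(iii) p.41] -/
theorem smul_edge (g : D.temperedPi h𝒢) (n : ℕ) :
    (T.smul g).edge n = (D.treeAct h𝒢 n g).hom.edgeMap (T.edge n) := by
  unfold edge
  rw [D.treeAct_apply, D.galTreeAct_edgeMap_mk h𝒢 n]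
  rfl

include hc in
/-- **The edge decomposition homomorphism at `g · t` is the conjugate by `g` of the one at `t`.**
[cite: MochizukiSemiAnbd2006, Thm 3.7(iii) p.41] -/
theorem decompHomE_smul (g : D.temperedPi h𝒢) (h : 𝒢.Ge e) :
    (T.smul g).decompHomE hc h = g * T.decompHomE hc h * g⁻¹ := by
  symm
  apply (T.smul g).eq_decompHomE hc
  intro n
  rw [map_mul, map_mul, map_inv, conj_hom]
  change ((D.proj h𝒢 n g).hom.fE e).hom.hom ((((D.proj h𝒢 n (T.decompHomE hc h))).hom.fE e).hom.hom
    (((D.proj h𝒢 n g).inv.fE e).hom.hom (((D.proj h𝒢 n g).hom.fE e).hom.hom (T.pt n)))) =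
    ((D.cover h𝒢 n).SE e).obj.ρ h⁻¹ (((D.proj h𝒢 n g).hom.fE e).hom.hom (T.pt n))
  rw [gal_inv_hom_applyE, T.proj_decompHomE_apply hc n h, CovHom.fE_ρ]

include hc in
/-- Hence the conjugate of the image at `t` is the image at `g · t` (edges).
[cite: MochizukiSemiAnbd2006, Thm 3.7(iii) p.41] -/
theorem range_decompHomE_smul (g : D.temperedPi h𝒢) :
    ((T.smul g).decompHomE hc).range = (T.decompHomE hc).range.map (MulAut.conj g).toMonoidHom := by
  ext x
  constructor
  · rintro ⟨h, rfl⟩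
    exact ⟨T.decompHomE hc h, ⟨h, rfl⟩, (T.decompHomE_smul hc g h).symm⟩
  · rintro ⟨y, ⟨h, rfl⟩, rfl⟩
    exact ⟨h, T.decompHomE_smul hc g h⟩

/-! ### Transitivity on compatible edge-point sequences -/

/-- Extensionality for compatible edge-point sequences. [cite: MochizukiSemiAnbd2006, Thm 3.7(iii) p.41] -/
theorem ext {T T' : D.EdgeSeq h𝒢 e} (h : ∀ n, T.pt n = T'.pt n) : T = T' := by
  obtain ⟨p, c⟩ := T
  obtain ⟨p', c'⟩ := T'
  obtain rfl : p = p' := funext h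
  rfl

include hc

/-- The automorphism of `𝒢_{∞,n}` carrying `t n` to `t' n` (edge fibres).
[cite: MochizukiSemiAnbd2006, Prop 3.6 p.38] -/
noncomputable def transporterGalE (T' : D.EdgeSeq h𝒢 e) (n : ℕ) : D.Gal h𝒢 n :=
  (D.exists_aut_apply_eqE h𝒢 hc n (T.pt n) (T'.pt n)).choose

/-- Its defining property. [cite: MochizukiSemiAnbd2006, Prop 3.6 p.38] -/
theorem transporterGalE_apply (T' : D.EdgeSeq h𝒢 e) (n : ℕ) :
    (((T.transporterGalE hc T' n).hom.fE e).hom.hom (T.pt n)) = T'.pt n :=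
  (D.exists_aut_apply_eqE h𝒢 hc n (T.pt n) (T'.pt n)).choose_spec

/-- Uniqueness (edge rigidity). [cite: MochizukiSemiAnbd2006, Prop 3.6 p.38] -/
theorem eq_transporterGalE (T' : D.EdgeSeq h𝒢 e) (n : ℕ) (η : D.Gal h𝒢 n)
    (hη : (η.hom.fE e).hom.hom (T.pt n) = T'.pt n) : η = T.transporterGalE hc T' n :=
  Iso.ext ((D.S n).univCoverOver_hom_ext_edge (Sum.inl (D.W n)) h𝒢 _ _ (T.pt n)
    (hη.trans (T.transporterGalE_apply hc T' n).symm))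

/-- Compatibility with `step`. [cite: MochizukiSemiAnbd2006, Prop 3.6 p.38] -/
theorem step_transporterGalE (T' : D.EdgeSeq h𝒢 e) (n : ℕ) :
    D.step h𝒢 n (T.transporterGalE hc T' (n + 1)) = T.transporterGalE hc T' n := by
  apply T.eq_transporterGalE hc T'
  rw [← T.compat n, ← D.stepCover_apply_autE h𝒢 n, T.transporterGalE_apply hc T' (n + 1), T'.compat n]

/-- The element of `π₁^temp(𝒢)` carrying the edge-point sequence `t` to `t'`.
[cite: MochizukiSemiAnbd2006, Thm 3.7(iii) p.41] -/
noncomputable def transporterE (T' : D.EdgeSeq h𝒢 e) : D.temperedPi h𝒢 :=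
  D.mkPi h𝒢 (fun n => T.transporterGalE hc T' n) (fun n => T.step_transporterGalE hc T' n)

/-- `transporterE t t' · t = t'`. [cite: MochizukiSemiAnbd2006, Thm 3.7(iii) p.41] -/
theorem smul_transporterE (T' : D.EdgeSeq h𝒢 e) : T.smul (T.transporterE hc T') = T' :=
  EdgeSeq.ext fun n => T.transporterGalE_apply hc T' n

/-- **`π₁^temp(𝒢)` acts transitively on the compatible edge-point sequences over an edge `e`.**
[cite: MochizukiSemiAnbd2006, Thm 3.7(iii) p.41] -/
theorem exists_smul_eqE (T' : D.EdgeSeq h𝒢 e) : ∃ g : D.temperedPi h𝒢, T.smul g = T' :=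
  ⟨T.transporterE hc T', T.smul_transporterE hc T'⟩

/-- Hence any two edge decomposition homomorphisms over the same edge are conjugate in `π₁^temp(𝒢)`.
[cite: MochizukiSemiAnbd2006, Thm 3.7(iii) p.41] -/
theorem exists_decompHomE_eq_conj (T' : D.EdgeSeq h𝒢 e) :
    ∃ g : D.temperedPi h𝒢, ∀ h, T'.decompHomE hc h = g * T.decompHomE hc h * g⁻¹ := by
  obtain ⟨g, rfl⟩ := T.exists_smul_eqE hc T'
  exact ⟨g, T.decompHomE_smul hc g⟩

end EdgeSeq

end GaloisLevelData

end ProfiniteSemiGraph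

end Literature.AnabelianGeometry.SemiGraphs
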